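import Summits.BirchSwinnertonDyer.Rank1Residual.SmallImageMu.MuDefectLeFineMuEdges
import Summits.BirchSwinnertonDyer.Rank1Residual.X10.CoreTheoremAOddPrimeHolds
import Summits.BirchSwinnertonDyer.Rank1Residual.X10.MuTransferThreeOfFine
import Summits.BirchSwinnertonDyer.BirchSwinnertonDyer.Theorems.X10bLeafAnalyticMuDischarged
import Literature.NumberTheory.EllipticCurves.IwasawaAlgebraMuQuotientProofs
import Literature.NumberTheory.EllipticCurves.Rank1Residual.X10OrdinaryTowerProofs
import Literature.NumberTheory.EllipticCurves.Rank1Residual.X9MuInvariant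
import Literature.NumberTheory.EllipticCurves.Kato2004.DivisibilityInputsZetaLine
import HarnessLib

set_option autoImplicit false

-- the summit and its single problem are both named `BirchSwinnertonDyer` (registry layout D-0017)
set_option linter.dupNamespace false

/-!
# D-0131 RECORD TARGET GREENBERG-1.11@3-IRR (print-conditional: modulo F1_ζ = Kato Thm 12.5/12.6 + §13 + §17.13
# construction; F1′ twin): Greenberg's Conjecture 1.11 (algebraic `μ = 0`) at `p = 3` for EVERY good-ordinary
# `E/ℚ` with `E[3]` irreducible — EITHER image — modulo ONE printed construction fact

Cell `bsd-f3-mu`, seat `bsd-f3-mu-p1` (lead prover, gen 4; `--supports stmt-BirchSwinnertonDyer-20682`, helper),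
director-bsd W-58 (ii) (2026-08-27T22:57:12Z: «GO on UNION (P1‴) … ONE Theorems composition file … no new named fact;
label D-0131 RECORD TARGET GREENBERG-1.11@3-IRR (print-conditional); evidence on 20682; it is a RECORD, not a line»).
Kernel body = the bookkeeping writer's de-risking sketch `HOME/imc/g9/W58Sketch.lean` §(ii) (planner-bsd-f3-mu-imc g9,
sha16 e13fe053af775b5d) VERBATIM up to the namespace; Theses-free; tree imports only; no definition, no new named
fact, no `sorry`.

WHAT IS PROVED.  For every elliptic curve `E/ℚ` (globally minimal `W`) with GOOD ORDINARY reduction at `3` and `E[3]`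
IRREDUCIBLE, every newform `f` of `E` (modularity displayed as the binder `f`, as in p578794 §2), the cyclotomic
`ℤ_3`-extension `κ` with topological generator `γ` matching the cyclotomic variable, and every Pontryagin-dual datum
`D` of `Sel_{3^∞}(E/ℚ_∞)`: `μ(X(E/ℚ_∞)) = 0` (`D.mu = 0`) — MODULO F1_ζ =
`Kato2004.exists_divisibilityInputs_fineQuotient_zeta` ALONE (`muAlg_eq_zero_three_irreducible_of_fine`); the same
keyed on the print cell's verbatim-composite restatement F1′ = `Kato2004.exists_divisibilityInputsZetaLine_fineQuotient_zeta`
(`…_of_zetaLine`, one port term); and the carrier currency `Rank1Residual.MuAlgZeroAt W 3` (`muAlgZeroAt_three_of_fine`).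

PROOF (a case split on the image, both halves already in the tree):
* `ρ̄_{E,3}` NOT surjective — THEOREM B-alg@3 (booked PRINT-CONDITIONAL, W-58 (i)): `X10.muAlg_eq_zero_three_of_fine`
  (p578794 §2: Core Theorem A at every odd prime `X10.coreTheoremAOddPrime_holds` + THEOREM B = crux 20682
  `AnalyticMuZeroX10b`, closed p576451, class-free form `AnalyticMuZeroThree.muAnZeroAt_three` p577975).
* `ρ̄_{E,3}` surjective — Kato's Thm. 17.4 at the pair FROM F1_ζ (`X10.kato_divisibility_of_fine`, clause (3): `∃ g ∈
  char_Λ X, ι g = L_3(f, α)` under `3`-adic surjectivity on the tower); the tower hypothesis is the TREE THEOREM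
  `Rank1Residual.surjective_pow_of_goodOrd_of_surj` (Wuthrich 2014 Lemma 20, proved in
  `Literature/…/Rank1Residual/X10OrdinaryTowerProofs.lean` — so no `hW3` binder); the divisor `g` has unit content
  because `L_3(f, α)` does (THEOREM B class-free, `muAnZeroAt_three`, via `Rank1Residual.hasUnitContent_of_map_eq`);
  `char_Λ X` is principal (`charIdeal_isPrincipal_holds`), so Greenberg–Vatsal's `μ = 0 ↔` unit content of the
  generator (`GreenbergVatsal2000.mu_eq_zero_iff_hasUnitContent`, `hasUnitContent_iff_not_C_dvd`) finishes — the pattern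
  of `SmallImageMu.muAlgZeroAt_of_katoDivisibilityAt_of_muAnZeroAt` with BCS 2025 replaced by principality.
INPUTS OF THE UNION = {F1_ζ} (or {F1′}) ALONE + the newform binder.  NOT used: `kato_divisibility` as a separate cite-only
fact (derived from F1_ζ), `hW3` (a theorem), the period unit A25/`h3`, BCS 2025, any route file.

HONEST FRAMING.  A RECORD, not a line: it closes no class and claims no rung credit; PARTITION unchanged (X9 790 =
130 5Ns + 36 7Ns + 624 5S4; X10b 883 = 610 3Ns + 273 3Nn).  Beyond-print status: the ¬Surj half is THEOREM B-alg@3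
(booked PRINT-CONDITIONAL modulo F1, director-bsd W-58 (i); ref1 g7 §3.13: F1 faithful field-by-field except ONE
declared Irr-only localisation clause at `𝔭 ∋ p`, judged true on paper — the F1′ twin has no such clause); the Surj
half is Kato 17.4 (3) + THEOREM B (the `μ^an` side is kernel-unconditional).  BSD is not proved by any of this.

References: R. Greenberg, LNM 1716 (1999), §1 Conj. 1.11 [GreenbergLNM1716]; K. Kato, Astérisque 295 (2004), Thm. 12.5,
Thm. 12.6 (p. 222), Ex. 13.3, (14.9.3) (p. 240), Thm. 17.4 (p. 273), §17.13 (pp. 279–280) [Kato2004Asterisque];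
R. Greenberg, V. Vatsal, Invent. Math. 142 (2000), (2)–(3) and Prop. 3.7 [GreenbergVatsal2000]; C. Wuthrich,
Doc. Math. 19 (2014), Lemma 20 (p. 399) [Wuthrich2014]; J.-P. Serre, Invent. Math. 15 (1972) [Serre1972].
-/

noncomputable section

open scoped Classical MatrixGroups ModularForm
open CongruenceSubgroup WeierstrassCurve Field
open Literature.NumberTheory.GaloisRepresentations
open Literature.NumberTheory.EllipticCurves Literature.NumberTheory.EllipticCurves.ModularForms
open Literature.NumberTheory.EllipticCurves.Kato2004
open Literature.NumberTheory.EllipticCurves.Kato2004.EulerSystemValues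
open Literature.NumberTheory.EllipticCurves.Rank1Residual
open Summit.BirchSwinnertonDyer.BirchSwinnertonDyer.Rank1Residual
open Summit.BirchSwinnertonDyer.BirchSwinnertonDyer.Rank1Residual.AnalyticMuZeroThree
open Summit.BirchSwinnertonDyer.Rank1Residual
open Module IwasawaAlgebra

namespace Summit.BirchSwinnertonDyer.BirchSwinnertonDyer.Theorems.GreenbergMuConjectureThreeIrreducibleOfFine

/-! ## §1 The UNION: Greenberg Conj. 1.11 (algebraic `μ`) at `p = 3`, good ordinary, `E[3]` irreducible, EITHER
image, modulo F1_ζ alone -/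

/-- **GREENBERG-1.11@3-IRR (print-conditional record): `μ₃^alg(E) = 0` for every good-ordinary `E/ℚ` with `E[3]`
irreducible, modulo F1_ζ alone.**  For `W` globally minimal elliptic, `3` good ordinary, `E[3]` irreducible, `f` a
newform of `W`, cyclotomic `(κ, γ)` matching the cyclotomic variable and every dual Selmer datum `D`: `D.mu = 0`.
Case split on the mod-`3` image: ¬Surj = `X10.muAlg_eq_zero_three_of_fine` (THEOREM B-alg@3, p578794 §2); Surj = Kato
17.4 (3) from F1_ζ on the good-ordinary tower (`X10.kato_divisibility_of_fine`, tower surjectivity by the tree theorem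
`surjective_pow_of_goodOrd_of_surj` = Wuthrich's Lemma 20) + unit content of `L_3(f, α)` (THEOREM B class-free,
`muAnZeroAt_three`) + principality of `char_Λ X` + Greenberg–Vatsal `μ = 0 ↔` unit content.
[cite: GreenbergLNM1716, §1 Conj. 1.11] [cite: Kato2004Asterisque, Thm. 12.6 (p. 222), Thm. 17.4 (p. 273), §17.13 (pp. 279–280)]
[cite: GreenbergVatsal2000, (2)–(3) and Prop. 3.7] [cite: Wuthrich2014, Lemma 20 (p. 399)] -/
theorem muAlg_eq_zero_three_irreducible_of_fine (hfine : exists_divisibilityInputs_fineQuotient_zeta) :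
    ∀ (W : WeierstrassCurve ℚ) [W.IsElliptic] [W.IsGloballyMinimal] {N : ℕ} [NeZero N]
      (f : CuspForm (Gamma0 N) 2),
      IsOrdinaryAt W 3 → W.HasIrreducibleModPGaloisRep 3 → IsNewformOf W f →
      ∀ (κ : ZpExtension ℚ 3) (γ : absoluteGaloisGroup ℚ),
        κ.IsCyclotomic → κ.IsTopGenerator γ → IsCyclotomicVariable 3 γ →
        ∀ D : W.SelmerDualData κ γ, D.mu = 0 := by
  intro W _ _ N _ f hord hirr hf κ γ hκ hγ hγ' D
  by_cases hs : W.HasSurjectiveModNGaloisRep 3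
  · -- `ρ̄_{E,3}` onto: Kato 17.4 (3) from F1 on the good-ordinary tower (Lemma 20 is a tree theorem) + THEOREM B
    haveI : Module.Finite (IwasawaAlgebra 3) D.X :=
      WeierstrassCurve.SelmerDualData.module_finite_of_isCyclotomic W κ hκ D hγ
    obtain ⟨hX, -, h3⟩ := X10.kato_divisibility_of_fine hfine W 3 κ γ N f (by decide) hord hκ hγ hγ' hf D
    obtain ⟨g, hg, hιg⟩ := h3 (surjective_pow_of_goodOrd_of_surj W (by decide) ⟨hord.1, hord.2⟩ hs)
    have hug : GreenbergVatsal2000.HasUnitContent g :=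
      hasUnitContent_of_map_eq g _ hιg (muAnZeroAt_three W hord hirr f hf)
    haveI : (D.charIdeal).IsPrincipal := charIdeal_isPrincipal_holds 3 D.X
    obtain ⟨c, hc⟩ := Submodule.IsPrincipal.principal D.charIdeal
    have hc' : D.charIdeal = Ideal.span {c} := hc
    refine (GreenbergVatsal2000.mu_eq_zero_iff_hasUnitContent D hX hc').mpr ?_
    rw [GreenbergVatsal2000.hasUnitContent_iff_not_C_dvd] at hug ⊢
    rw [hc', Ideal.mem_span_singleton] at hg
    exact fun hdvd => hug (hdvd.trans hg)
  · -- `ρ̄_{E,3}` not onto: THEOREM B-alg@3 (class X10b, Core Theorem A + THEOREM B), p578794 §2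
    exact X10.muAlg_eq_zero_three_of_fine hfine W f hord hirr hs hf κ γ hκ hγ hγ' D

/-- **The same record keyed on F1′** (`Kato2004.exists_divisibilityInputsZetaLine_fineQuotient_zeta`, the print cell's
VERBATIM-COMPOSITE restatement of Kato's package, weaker than print and with no Irr-only localisation clause; one port
term `exists_divisibilityInputs_fineQuotient_zeta_of_zetaLine`).
[cite: Kato2004Asterisque, Thm. 12.5 (p. 222), Thm. 12.6 (p. 222), Ex. 13.3 (p. 225), (14.9.3) (p. 240) and §17.13 (p. 279)]
[cite: GreenbergLNM1716, §1 Conj. 1.11] -/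
theorem muAlg_eq_zero_three_irreducible_of_zetaLine
    (hzeta : exists_divisibilityInputsZetaLine_fineQuotient_zeta) :
    ∀ (W : WeierstrassCurve ℚ) [W.IsElliptic] [W.IsGloballyMinimal] {N : ℕ} [NeZero N]
      (f : CuspForm (Gamma0 N) 2),
      IsOrdinaryAt W 3 → W.HasIrreducibleModPGaloisRep 3 → IsNewformOf W f →
      ∀ (κ : ZpExtension ℚ 3) (γ : absoluteGaloisGroup ℚ),
        κ.IsCyclotomic → κ.IsTopGenerator γ → IsCyclotomicVariable 3 γ →
        ∀ D : W.SelmerDualData κ γ, D.mu = 0 :=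
  muAlg_eq_zero_three_irreducible_of_fine (exists_divisibilityInputs_fineQuotient_zeta_of_zetaLine hzeta)

/-! ## §2 Carrier currency -/

/-- **Carrier currency: `Rank1Residual.MuAlgZeroAt W 3`** (`μ^alg(E, 3) = 0` over all cyclotomic data) for every
good-ordinary `W` with `E[3]` irreducible, modulo F1_ζ and a newform `f` of `W` (modularity displayed as the binder).
[cite: GreenbergVatsal2000, p. 2, (1) (definition of μ^alg)] [cite: GreenbergLNM1716, §1 Conj. 1.11] -/
theorem muAlgZeroAt_three_of_fine (hfine : exists_divisibilityInputs_fineQuotient_zeta)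
    (W : WeierstrassCurve ℚ) [W.IsElliptic] [W.IsGloballyMinimal] {N : ℕ} [NeZero N]
    (f : CuspForm (Gamma0 N) 2) (hord : IsOrdinaryAt W 3) (hirr : W.HasIrreducibleModPGaloisRep 3)
    (hf : IsNewformOf W f) : MuAlgZeroAt W 3 :=
  fun κ γ hκ hγ hγ' D => muAlg_eq_zero_three_irreducible_of_fine hfine W f hord hirr hf κ γ hκ hγ hγ' D

/-- **Carrier currency keyed on F1′.** [cite: GreenbergVatsal2000, p. 2, (1)] [cite: GreenbergLNM1716, §1 Conj. 1.11] -/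
theorem muAlgZeroAt_three_of_zetaLine (hzeta : exists_divisibilityInputsZetaLine_fineQuotient_zeta)
    (W : WeierstrassCurve ℚ) [W.IsElliptic] [W.IsGloballyMinimal] {N : ℕ} [NeZero N]
    (f : CuspForm (Gamma0 N) 2) (hord : IsOrdinaryAt W 3) (hirr : W.HasIrreducibleModPGaloisRep 3)
    (hf : IsNewformOf W f) : MuAlgZeroAt W 3 :=
  muAlgZeroAt_three_of_fine (exists_divisibilityInputs_fineQuotient_zeta_of_zetaLine hzeta) W f hord hirr hf

/-- **With a modular-parametrisation supply** (`hmodP`, Wiles / Taylor–Wiles / BCDT, displayed): `μ^alg(E, 3) = 0`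
for every good-ordinary `E/ℚ` with `E[3]` irreducible, modulo F1_ζ — the newform binder discharged by `hmodP`.
[cite: GreenbergLNM1716, §1 Conj. 1.11] [cite: BCDT2001, Thm. A] -/
theorem muAlgZeroAt_three_of_fine_of_modular (hmodP : nonempty_modularParametrizationData)
    (hfine : exists_divisibilityInputs_fineQuotient_zeta)
    (W : WeierstrassCurve ℚ) [W.IsElliptic] [W.IsGloballyMinimal] (hord : IsOrdinaryAt W 3)
    (hirr : W.HasIrreducibleModPGaloisRep 3) : MuAlgZeroAt W 3 := by
  haveI : NeZero (W.conductorNorm ℤ) := ⟨(W.conductorNorm_pos_holds).ne'⟩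
  obtain ⟨Dm⟩ := hmodP W
  exact muAlgZeroAt_three_of_fine hfine W Dm.f hord hirr Dm.isNewformOf

end Summit.BirchSwinnertonDyer.BirchSwinnertonDyer.Theorems.GreenbergMuConjectureThreeIrreducibleOfFine

end
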